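import Literature.MathematicalPhysics.QuantumFieldTheory.Balaban1983to89.T4TubeBudget
import Literature.MathematicalPhysics.QuantumFieldTheory.Balaban1983to89.B14FlowStep

/-!
# T4UniformRadius — the K-uniform μ-radius arithmetic of node O4 (cell `pub-balaban`, T4-DAG v3 §5 row T4-O4.K; bookkeeping)

HONEST FRAMING (cell `pub-balaban`, T4-DAG PAGE 1).  The cell's T4 target is the existence AND uniqueness of the
continuum limit of Bałaban's unit-scale averaged loop expectations on a finite torus — a constructive-QFT statement
strictly beyond ultraviolet stability ([Balaban1989LargeFieldII] Thm 1 p. 355); it is NOT the Yang–Mills mass gap and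
NOT the Clay problem.  This module is the KERNEL ARITHMETIC behind one sentence of the cell's referee record
`t4/T4-REF-O3.md` v1 (V3, end — a cell ANALYSIS, NOT in print): the one-step μ-radius of the tree's oscillation
sandwich (`T4OscSandwich.ropRealIn_loopDressing_sandwich_unif`, whose exponent is `|t|·(C_W·|w|·N·θⁿ)` with `N` a bound
on the number of fibre bonds and `n` the number of averaging steps) is UNIFORM IN THE NUMBER OF STEPS `K`, because
along the flow the sizes `R_j` of the printed domain geometry grow only POLYNOMIALLY in the number `K − j` of
remaining scales (with an arbitrarily small exponent), while `θ^{K−j}` decays GEOMETRICALLY.  It asserts NOTHING about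
Bałaban's renormalization-group objects: the counts `N j`, sizes `R j`, couplings `g j` are ABSTRACT sequences; the
printed inequality (2.9) of [Balaban1988Convergent] enters only as the tree's HYPOTHESIS SHAPE
`B14FlowStep.FlowIneq29 R g L β' β₀ K` (typed verbatim there; the paper states it as a consequence of the
renormalization group equations — it is a hypothesis here, never a fact), and the alternative keying to the UPPER
half of (0.31) of [Balaban1987RG1] is the tree's `Step.Discrete031` via `T4TubeBudget.radius_pow_mul_geom_le_of_discrete031`.
Every theorem is elementary real analysis (`Real.rpow` monotonicity, finite geometric-versus-polynomial comparison
from `T4TubeBudget` §4).  Value = kernel bookkeeping of an implication ⇐ named inputs; NOT summit progress.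

Printed context (verbatim, page-cited, read on the journal page images; the manuscript under audit is quoted for
CONTEXT only — no disputed step of it is used anywhere below).  [Balaban1988Convergent] p. 255: "Z_j = Λ_j^c . (2.3)
These large field regions satisfy the following condition: if a component of Z_j is contained in a cube of the size
100MR_j (in the L^{−j}-lattice), then it is a rectangular parallelepiped." and "R_j is the smallest number of the
form L^r such, that R_j ≥ (log g_j^{−2})^r . (2.5)"; p. 256: "R_n ≤ LR_m , R_m ≤ L(1 + g_n²β′(n−m))^{β₀}R_n ≤
(L+1)(n−m)^{β₀}R_n . (2.9) Similar inequalities hold for other constants, which will be introduced later. The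
domains Ω_j, Λ_j, which are determined by he j-th renormalization transformation, but not by the R-operation, are
unions of MR_j-cubes in the lattice T_{L^{−j}}." (sic "he"), where (p. 255, after (2.6)) "n > m, and β₀ > 0 can be
chosen arbitrarily small, if g is sufficiently small."  [cite: Balaban1988Convergent, (2.3)/(2.5) p.255; (2.9) p.256]
How the cell uses them (T4-REF-O3 v1 V3, cell ANALYSIS, not in print): a large-field component felt by the loop at
scale `j` that lies in a cube of size `100MR_j` carries at most `4·(100M R_j)⁴` bonds (a d·side^d count, d = 4), so
the one-step sandwich's exponent for the terms born at scale `j` is `|μ|·C_W·|w|·4(100MR_j)⁴·θ_av^{K−j}`, and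
"sup_j 4(100MR_j)⁴θ_av^{K−j} is K-uniform because R_j grows only polylogarithmically in g_j^{−1} toward the
ultraviolet while θ_av^{K−j} decays geometrically — so μ₀ … > 0 is K-uniform".  The count `4(100M)⁴` and the rate
`θ_av` are the cell's; here they are the abstract parameters `B` and `θ`.

What is proved (all [folklore]; `j ≤ K` throughout, `K − j` = number of remaining scales, exact under the binder).
§1 FROM (2.9) TO A POLYNOMIAL PROFILE.  `FlowIneq29 R g L β' β₀ K` (its second member at `n = K`), `1 ≤ L`, `0 ≤ β'`,
   `0 ≤ β₀` give `R j ≤ A_K · ((K−j)+1)^q` for every `j ≤ K`, with `q = ⌈β₀⌉₊` and `A_K = L(1 + g_K²β′)^q R_K`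
   (`radius_profile_of_flowIneq29`; `(1 + c·x)^{β₀} ≤ ((1+c)(x+1))^q` is `one_add_mul_rpow_le`); hence
   `R j⁴ θ^{K−j} ≤ A_K⁴ · C_{4q}(θ)` for `0 ≤ θ < 1` (`radius_pow_mul_geom_le_of_flowIneq29`, `C_q(θ) =
   T4TubeBudget.geomPolyConst q θ = Σ' (m+1)^q θ^m`).  The constant depends on `K` ONLY through the final-scale data
   `g_K`, `R_K` (the renormalised coupling and its (2.5)-size), which is what "K-uniform at fixed renormalised
   coupling" means; it is NOT uniform as `g_K → 0` (then `R_K → ∞`) — recorded, since the cell sentence writes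
   `μ₀(L, M, C_W)`.
§2 THE μ-RADIUS.  `OscExponentBound C_W ℓ N θ K t c := ∀ j ≤ K, |t|·(C_W·ℓ·N j·θ^{K−j}) ≤ c` is the tree sandwich's
   exponent shape, scale by scale (`ℓ` = the loop length `|w|`, `N j` the fibre-bond bound for the terms born at
   scale `j`, `n = K − j` averaging steps).  If `N j ≤ B·R j⁴` and `R j⁴θ^{K−j} ≤ Γ` for `j ≤ K` then
   `|t|·C_W·ℓ·B·Γ ≤ c` implies it (`oscExponentBound_of_profile`), i.e. every `|t| ≤ μ₀ := c/(C_W ℓ B Γ)` works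
   (`oscExponentBound_of_le_radius`, positive data); assembled with §1: `oscExponentBound_of_flowIneq29`, and with
   `T4TubeBudget.radius_pow_mul_geom_le_of_discrete031` ((0.31)-keyed radii `R j ≤ D(log gs_j⁻²)^r`):
   `oscExponentBound_of_discrete031`.  K-UNIFORMITY (`uniform_radius_of_flowIneq29`): for a K-indexed FAMILY of
   sequences obeying (2.9) at every `K` with the SAME final data `g_K = g_fin`, `R_K = R_fin`, one `μ₀ > 0` serves every
   `K` and every `j ≤ K`.

Deliberately NOT here: that Bałaban's couplings/sizes obey (2.9) or (0.31) (hypotheses; tree `B14FlowStep.flowIneq29_of_27`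
derives (2.9) from (2.7) + (2.5), and `B12Beta`/`Beta.*` discuss (0.31) — COND-BetaPertH); the bond count of a
component (the `4(100M)⁴`; parameter `B`); the identification of `θ` with an averaging rate and of the exponent
with a D-term (rows O3.E-i, O3b.K; `T4OscSandwich` is NOT imported — the shape `OscExponentBound` matches its exponent
literally and the consumer instantiates); anything about sizes in the tube budget (TOB-k) (that is `T4TubeBudget`
§§2–3: radius yes, size no — T4-REF-O3 V3).
-/

namespace Literature.MathematicalPhysics.QuantumFieldTheory.Balaban1983to89.T4UniformRadius

open Finset T4TubeBudget

/-! ## §1 From the printed flow inequality (2.9) to a polynomial profile of the sizes -/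

/-- `1 + c·x ≤ (1 + c)·(x + 1)` for `c, x ≥ 0`. [folklore] -/
theorem one_add_mul_le {c x : ℝ} (hc : 0 ≤ c) (hx : 0 ≤ x) : 1 + c * x ≤ (1 + c) * (x + 1) := by
  nlinarith

/-- A real power of a base `≥ 1` is at most the natural power `⌈β₀⌉₊` of the exponent's ceiling. [folklore] -/
theorem rpow_le_pow_natCeil {y : ℝ} (hy : 1 ≤ y) (β₀ : ℝ) : y ^ β₀ ≤ y ^ ⌈β₀⌉₊ := by
  have h := Real.rpow_le_rpow_of_exponent_le hy (Nat.le_ceil β₀)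
  rwa [Real.rpow_natCast] at h

/-- `(1 + c·x)^{β₀} ≤ (1 + c)^q · (x + 1)^q` with `q = ⌈β₀⌉₊`, for `c, x, β₀ ≥ 0` — the polynomial envelope of the
printed factor `(1 + g_n²β′(n−m))^{β₀}` of (2.9). [folklore] -/
theorem one_add_mul_rpow_le {c x β₀ : ℝ} (hc : 0 ≤ c) (hx : 0 ≤ x) (hβ₀ : 0 ≤ β₀) :
    (1 + c * x) ^ β₀ ≤ (1 + c) ^ ⌈β₀⌉₊ * (x + 1) ^ ⌈β₀⌉₊ := by
  have h0 : 0 ≤ 1 + c * x := by positivity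
  have h1 : 1 ≤ (1 + c) * (x + 1) := by nlinarith
  calc (1 + c * x) ^ β₀ ≤ ((1 + c) * (x + 1)) ^ β₀ := Real.rpow_le_rpow h0 (one_add_mul_le hc hx) hβ₀
    _ ≤ ((1 + c) * (x + 1)) ^ ⌈β₀⌉₊ := rpow_le_pow_natCeil h1 β₀
    _ = (1 + c) ^ ⌈β₀⌉₊ * (x + 1) ^ ⌈β₀⌉₊ := mul_pow _ _ _

/-- **THE SIZES HAVE A POLYNOMIAL PROFILE IN THE REMAINING SCALES** (from the HYPOTHESIS SHAPE (2.9),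
`B14FlowStep.FlowIneq29`, second member at `n = K`): `R j ≤ L(1 + g_K²β′)^q R_K · ((K−j)+1)^q`, `q = ⌈β₀⌉₊`, for every
`j ≤ K`.  Printed (2.9) p. 256: *"R_m ≤ L(1 + g_n²β′(n−m))^{β₀}R_n ≤ (L+1)(n−m)^{β₀}R_n"* — used as a hypothesis on
abstract sequences, never as a fact. [cite: Balaban1988Convergent, (2.9) p.256] -/
theorem radius_profile_of_flowIneq29 {R : ℕ → ℕ} {g : ℕ → ℝ} {L : ℕ} {β' β₀ : ℝ} {K : ℕ}
    (h29 : B14FlowStep.FlowIneq29 R g L β' β₀ K) (hL : 1 ≤ L) (hβ' : 0 ≤ β') (hβ₀ : 0 ≤ β₀) {j : ℕ} (hj : j ≤ K) :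
    (R j : ℝ) ≤ (L : ℝ) * (1 + (g K) ^ 2 * β') ^ ⌈β₀⌉₊ * (R K : ℝ) * ((((K - j : ℕ) : ℝ)) + 1) ^ ⌈β₀⌉₊ := by
  have hL' : (1 : ℝ) ≤ L := by exact_mod_cast hL
  have hc : 0 ≤ (g K) ^ 2 * β' := by positivity
  have hRK : 0 ≤ (R K : ℝ) := Nat.cast_nonneg _
  have hpre : 1 ≤ (L : ℝ) * (1 + (g K) ^ 2 * β') ^ ⌈β₀⌉₊ :=
    one_le_mul_of_one_le_of_one_le hL' (one_le_pow₀ (by linarith))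
  rcases hj.lt_or_eq with hlt | heq
  · have h2 := (h29 j K hlt le_rfl).2
    have hx : ((K : ℝ) - j) = (((K - j : ℕ) : ℝ)) := by rw [Nat.cast_sub hj]
    rw [hx] at h2
    have hxn : 0 ≤ (((K - j : ℕ) : ℝ)) := Nat.cast_nonneg _
    have henv : (1 + (g K) ^ 2 * β' * (((K - j : ℕ) : ℝ))) ^ β₀
        ≤ (1 + (g K) ^ 2 * β') ^ ⌈β₀⌉₊ * ((((K - j : ℕ) : ℝ)) + 1) ^ ⌈β₀⌉₊ := one_add_mul_rpow_le hc hxn hβ₀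
    calc (R j : ℝ) ≤ (L : ℝ) * (1 + (g K) ^ 2 * β' * (((K - j : ℕ) : ℝ))) ^ β₀ * (R K : ℝ) := h2
      _ ≤ (L : ℝ) * ((1 + (g K) ^ 2 * β') ^ ⌈β₀⌉₊ * ((((K - j : ℕ) : ℝ)) + 1) ^ ⌈β₀⌉₊) * (R K : ℝ) :=
          mul_le_mul_of_nonneg_right (mul_le_mul_of_nonneg_left henv (by positivity)) hRK
      _ = (L : ℝ) * (1 + (g K) ^ 2 * β') ^ ⌈β₀⌉₊ * (R K : ℝ) * ((((K - j : ℕ) : ℝ)) + 1) ^ ⌈β₀⌉₊ := by ring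
  · subst heq
    have e : ((((j - j : ℕ) : ℝ)) + 1) ^ ⌈β₀⌉₊ = 1 := by simp
    rw [e, mul_one]
    calc (R j : ℝ) = 1 * (R j : ℝ) := (one_mul _).symm
      _ ≤ (L : ℝ) * (1 + (g j) ^ 2 * β') ^ ⌈β₀⌉₊ * (R j : ℝ) := mul_le_mul_of_nonneg_right hpre hRK

/-- **SIZES⁴ AGAINST GEOMETRIC DECAY, keyed to (2.9)**: under `FlowIneq29 R g L β' β₀ K`, `1 ≤ L`, `β', β₀ ≥ 0`,
`0 ≤ θ < 1`: `R j⁴ · θ^{K−j} ≤ (L(1 + g_K²β′)^q R_K)⁴ · C_{4q}(θ)` for every `j ≤ K` (`q = ⌈β₀⌉₊`,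
`C_q = T4TubeBudget.geomPolyConst`).  The constant depends on `K` only through `g_K`, `R_K`. [folklore] -/
theorem radius_pow_mul_geom_le_of_flowIneq29 {R : ℕ → ℕ} {g : ℕ → ℝ} {L : ℕ} {β' β₀ θ : ℝ} {K : ℕ}
    (h29 : B14FlowStep.FlowIneq29 R g L β' β₀ K) (hL : 1 ≤ L) (hβ' : 0 ≤ β') (hβ₀ : 0 ≤ β₀) (hθ0 : 0 ≤ θ)
    (hθ1 : θ < 1) {j : ℕ} (hj : j ≤ K) :
    (R j : ℝ) ^ 4 * θ ^ (K - j)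
      ≤ ((L : ℝ) * (1 + (g K) ^ 2 * β') ^ ⌈β₀⌉₊ * (R K : ℝ)) ^ 4 * geomPolyConst (4 * ⌈β₀⌉₊) θ :=
  radius_pow_mul_geom_le (R := fun i => (R i : ℝ)) (by positivity) hθ0 hθ1 (fun i _ => Nat.cast_nonneg _)
    (fun i hi => radius_profile_of_flowIneq29 h29 hL hβ' hβ₀ hi) hj

/-! ## §2 The μ-radius of the one-step oscillation sandwich, scale by scale -/

/-- HYPOTHESIS/TARGET SHAPE — the exponent of the tree's one-step oscillation sandwich, scale by scale (the shape of
`|t| * (C_W * (w.length : ℝ) * (N : ℝ) * θ ^ n)` in `T4OscSandwich.ropRealIn_loopDressing_sandwich_unif` with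
`n = K − j`, `ℓ = |w|`, `N = N j`): for every birth scale `j ≤ K` the exponent is at most `c`.  Cell analysis
T4-REF-O3 V3 (NOT PRINTED). [folklore] -/
def OscExponentBound (C_W ℓ : ℝ) (N : ℕ → ℕ) (θ : ℝ) (K : ℕ) (t c : ℝ) : Prop :=
  ∀ j ≤ K, |t| * (C_W * ℓ * (N j : ℝ) * θ ^ (K - j)) ≤ c

/-- Unfolding. [folklore] -/
theorem oscExponentBound_iff {C_W ℓ : ℝ} {N : ℕ → ℕ} {θ : ℝ} {K : ℕ} {t c : ℝ} :
    OscExponentBound C_W ℓ N θ K t c ↔ ∀ j ≤ K, |t| * (C_W * ℓ * (N j : ℝ) * θ ^ (K - j)) ≤ c :=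
  Iff.rfl

/-- **RADIUS FROM A PROFILE BOUND**: counts `N j ≤ B·R j⁴`, profile `R j⁴ θ^{K−j} ≤ Γ` (`j ≤ K`), nonnegative
`C_W, ℓ, B, θ`, and `|t|·(C_W ℓ B Γ) ≤ c` give the exponent bound `c` at every scale. [folklore] -/
theorem oscExponentBound_of_profile {C_W ℓ B Γ θ t c : ℝ} {N : ℕ → ℕ} {R : ℕ → ℝ} {K : ℕ} (hCW : 0 ≤ C_W)
    (hℓ : 0 ≤ ℓ) (hB : 0 ≤ B) (hθ : 0 ≤ θ) (hN : ∀ j ≤ K, (N j : ℝ) ≤ B * R j ^ 4)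
    (hR : ∀ j ≤ K, R j ^ 4 * θ ^ (K - j) ≤ Γ) (ht : |t| * (C_W * ℓ * B * Γ) ≤ c) :
    OscExponentBound C_W ℓ N θ K t c := by
  intro j hj
  have h1 : (N j : ℝ) * θ ^ (K - j) ≤ B * Γ :=
    calc (N j : ℝ) * θ ^ (K - j) ≤ B * R j ^ 4 * θ ^ (K - j) :=
          mul_le_mul_of_nonneg_right (hN j hj) (pow_nonneg hθ _)
      _ = B * (R j ^ 4 * θ ^ (K - j)) := by ring
      _ ≤ B * Γ := mul_le_mul_of_nonneg_left (hR j hj) hB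
  calc |t| * (C_W * ℓ * (N j : ℝ) * θ ^ (K - j)) = |t| * (C_W * ℓ) * ((N j : ℝ) * θ ^ (K - j)) := by ring
    _ ≤ |t| * (C_W * ℓ) * (B * Γ) := mul_le_mul_of_nonneg_left h1 (by positivity)
    _ = |t| * (C_W * ℓ * B * Γ) := by ring
    _ ≤ c := ht

/-- **THE RADIUS `μ₀ = c/(C_W ℓ B Γ)`** (positive data): every `|t| ≤ μ₀` meets the exponent bound. [folklore] -/
theorem oscExponentBound_of_le_radius {C_W ℓ B Γ θ t c : ℝ} {N : ℕ → ℕ} {R : ℕ → ℝ} {K : ℕ} (hCW : 0 < C_W)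
    (hℓ : 0 < ℓ) (hB : 0 < B) (hΓ : 0 < Γ) (hθ : 0 ≤ θ) (hN : ∀ j ≤ K, (N j : ℝ) ≤ B * R j ^ 4)
    (hR : ∀ j ≤ K, R j ^ 4 * θ ^ (K - j) ≤ Γ) (ht : |t| ≤ c / (C_W * ℓ * B * Γ)) :
    OscExponentBound C_W ℓ N θ K t c := by
  have hden : 0 < C_W * ℓ * B * Γ := by positivity
  exact oscExponentBound_of_profile hCW.le hℓ.le hB.le hθ hN hR ((le_div_iff₀ hden).mp ht)

/-- **KEYED TO (2.9)** (`FlowIneq29`): with `Γ_K := (L(1 + g_K²β′)^q R_K)⁴ · C_{4q}(θ)`, counts `N j ≤ B·R j⁴` and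
`|t|·(C_W ℓ B Γ_K) ≤ c` give the exponent bound at every `j ≤ K`. [folklore] -/
theorem oscExponentBound_of_flowIneq29 {R : ℕ → ℕ} {g : ℕ → ℝ} {L : ℕ} {β' β₀ θ C_W ℓ B t c : ℝ} {K : ℕ}
    {N : ℕ → ℕ} (h29 : B14FlowStep.FlowIneq29 R g L β' β₀ K) (hL : 1 ≤ L) (hβ' : 0 ≤ β') (hβ₀ : 0 ≤ β₀)
    (hθ0 : 0 ≤ θ) (hθ1 : θ < 1) (hCW : 0 ≤ C_W) (hℓ : 0 ≤ ℓ) (hB : 0 ≤ B)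
    (hN : ∀ j ≤ K, (N j : ℝ) ≤ B * (R j : ℝ) ^ 4)
    (ht : |t| * (C_W * ℓ * B *
      (((L : ℝ) * (1 + (g K) ^ 2 * β') ^ ⌈β₀⌉₊ * (R K : ℝ)) ^ 4 * geomPolyConst (4 * ⌈β₀⌉₊) θ)) ≤ c) :
    OscExponentBound C_W ℓ N θ K t c :=
  oscExponentBound_of_profile (R := fun i => (R i : ℝ)) hCW hℓ hB hθ0 hN
    (fun _ hj => radius_pow_mul_geom_le_of_flowIneq29 h29 hL hβ' hβ₀ hθ0 hθ1 hj) ht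

/-- **KEYED TO (0.31)** (`Step.Discrete031`, upper half; radii `R j ≤ D(log gs_j⁻²)^r`, couplings in `]0,1]`; via
`T4TubeBudget.radius_pow_mul_geom_le_of_discrete031`): with `Γ := (D(1/g² + β′)^r)⁴ · C_{4r}(θ)` — a function of the
FINAL coupling `g` only — counts `N j ≤ B·R j⁴` and `|t|·(C_W ℓ B Γ) ≤ c` give the exponent bound at every `j ≤ K`.
[folklore] -/
theorem oscExponentBound_of_discrete031 {b β' g D θ C_W ℓ B t c : ℝ} {K r : ℕ} {gs R : ℕ → ℝ} {N : ℕ → ℕ}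
    (h : Step.Discrete031 b β' K g gs) (hβ' : 0 ≤ β') (hD : 0 ≤ D) (hθ0 : 0 ≤ θ) (hθ1 : θ < 1)
    (hgs0 : ∀ j ≤ K, 0 < gs j) (hgs1 : ∀ j ≤ K, gs j ≤ 1) (hR0 : ∀ j ≤ K, 0 ≤ R j)
    (hR : ∀ j ≤ K, R j ≤ D * (Real.log ((gs j) ^ 2)⁻¹) ^ r) (hCW : 0 ≤ C_W) (hℓ : 0 ≤ ℓ) (hB : 0 ≤ B)
    (hN : ∀ j ≤ K, (N j : ℝ) ≤ B * R j ^ 4)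
    (ht : |t| * (C_W * ℓ * B * ((D * (1 / g ^ 2 + β') ^ r) ^ 4 * geomPolyConst (4 * r) θ)) ≤ c) :
    OscExponentBound C_W ℓ N θ K t c :=
  oscExponentBound_of_profile hCW hℓ hB hθ0 hN
    (fun _ hj => radius_pow_mul_geom_le_of_discrete031 h hβ' hD hθ0 hθ1 hgs0 hgs1 hR0 hR hj) ht

/-- **K-UNIFORMITY** (row text: "μ₀ … K-uniformly"): for a `K`-indexed FAMILY of size and coupling sequences obeying
(2.9) at every `K` with the SAME final-scale data (`g K K = g_fin`, `R K K = R_fin` — fixed renormalised coupling and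
its (2.5)-size), counts `N K j ≤ B·(R K j)⁴`, positive `C_W, ℓ, B` and `0 ≤ θ < 1`, there is ONE `μ₀ > 0` such that
`|t| ≤ μ₀` gives the exponent bound `c` at every `K` and every `j ≤ K` (any `c > 0`).  The radius depends on
`L, β′, β₀, θ, C_W, ℓ, B, c` and on the final data `g_fin, R_fin` — NOT on `K`. [folklore] -/
theorem uniform_radius_of_flowIneq29 {R : ℕ → ℕ → ℕ} {g : ℕ → ℕ → ℝ} {N : ℕ → ℕ → ℕ} {L : ℕ}
    {β' β₀ θ C_W ℓ B c g_fin : ℝ} {R_fin : ℕ} (h29 : ∀ K, B14FlowStep.FlowIneq29 (R K) (g K) L β' β₀ K)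
    (hfin_g : ∀ K, g K K = g_fin) (hfin_R : ∀ K, R K K = R_fin) (hL : 1 ≤ L) (hβ' : 0 ≤ β') (hβ₀ : 0 ≤ β₀)
    (hθ0 : 0 ≤ θ) (hθ1 : θ < 1) (hCW : 0 < C_W) (hℓ : 0 < ℓ) (hB : 0 < B) (hc : 0 < c)
    (hN : ∀ K, ∀ j ≤ K, (N K j : ℝ) ≤ B * (R K j : ℝ) ^ 4) :
    ∃ μ₀ : ℝ, 0 < μ₀ ∧ ∀ K (t : ℝ), |t| ≤ μ₀ → OscExponentBound C_W ℓ (N K) θ K t c := by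
  set Γ : ℝ := ((L : ℝ) * (1 + g_fin ^ 2 * β') ^ ⌈β₀⌉₊ * (R_fin : ℝ)) ^ 4 * geomPolyConst (4 * ⌈β₀⌉₊) θ with hΓ
  have hΓ0 : 0 ≤ Γ := mul_nonneg (pow_nonneg (by positivity) 4) (geomPolyConst_nonneg _ hθ0)
  refine ⟨c / (C_W * ℓ * B * Γ + 1), by positivity, fun K t ht => ?_⟩
  have hprof : ∀ j ≤ K, ((R K j : ℕ) : ℝ) ^ 4 * θ ^ (K - j) ≤ Γ := by
    intro j hj
    have h := radius_pow_mul_geom_le_of_flowIneq29 (h29 K) hL hβ' hβ₀ hθ0 hθ1 hj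
    rwa [hfin_g K, hfin_R K] at h
  refine oscExponentBound_of_profile (R := fun i => ((R K i : ℕ) : ℝ)) hCW.le hℓ.le hB.le hθ0 (hN K) hprof ?_
  have hden : 0 < C_W * ℓ * B * Γ + 1 := by positivity
  have h1 : |t| * (C_W * ℓ * B * Γ + 1) ≤ c := (le_div_iff₀ hden).mp ht
  have h2 : |t| * (C_W * ℓ * B * Γ) ≤ |t| * (C_W * ℓ * B * Γ + 1) :=
    mul_le_mul_of_nonneg_left (by linarith) (abs_nonneg t)
  exact h2.trans h1

end Literature.MathematicalPhysics.QuantumFieldTheory.Balaban1983to89.T4UniformRadius
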